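import Summits.ResolutionOfSingularities.ResolutionOfSingularities.Theorems.FrobeniusLadderFRationalResolutionToricStalks
import Summits.ResolutionOfSingularities.ResolutionOfSingularities.Theorems.FrobeniusLadderFRationalResolutionToricReduceMod
import Summits.ResolutionOfSingularities.ResolutionOfSingularities.Theorems.FrobeniusLadderFRationalResolutionToricDegenerateRegular
import Summits.ResolutionOfSingularities.ResolutionOfSingularities.Theorems.FrobeniusLadderFRationalResolutionToricDimension
import Summits.ResolutionOfSingularities.ResolutionOfSingularities.Theorems.FrobeniusLadderFRationalResolutionToricVertexSingular
import Summits.ResolutionOfSingularities.ResolutionOfSingularities.Theorems.FrobeniusLadderFRationalResolutionToricRetract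
import Literature.AlgebraicGeometry.Resolution.ResolutionOfComponents
import HarnessLib

/-!
# Toric surface programme: ALL `(r, a)`; the vertex is singular; `Reg U(r,a) = D(x) ∪ D(w)` unconditionally

Support file for crux stmt-ResolutionOfSingularities-15317 (`FrobeniusLadder.FRationalResolution`), line `redirect`,
lead c4 (assembly of wave 3). With `TA[r,a] = k[{m ∈ ℤ² : 0 ≤ m₂, a m₂ ≤ r m₁}] ⊆ k[ℤ²]`, `U(r,a) = Spec TA[r,a]`:

* `hasResolution_toricSurface_all` — **every `U(r,a)`, ALL `r, a : ℕ`, every field, has a resolution of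
  singularities**: `r = 0` is regular (`stub_toric_degenerate_isRegularRing`), and for `r ≥ 1`,
  `TA[r,a] ≅ TA[r, a % r]` (`stub_toric_reduce_mod`) reduces to the Hirzebruch–Jung tower
  (`hasResolution_toricSurface`, `a % r < r`);
* `toric_exists_vertex` — for `1 ≤ r` some prime contains `x = χ^(1,0)` and `w = χ^(a,r)` (the constant
  coefficient of `s x + t w` vanishes);
* `toric_vertex_not_mem_regularLocus` — for `1 ≤ a < r` the vertex is a SINGULAR point (`stub_toric_ringKrullDim`,
  `stub_toric_vertex_not_regular`, `Spec.stalkIso`): the members `U(r,a)`, `1 ≤ a < r`, of the residual class are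
  genuinely singular surfaces;
* `toric_regularLocus_eq_of_lt` — hence `Reg U(r,a) = D(x) ∪ D(w)` with no hypothesis (cf. `toric_regularLocus_eq`).

All folklore (CLS 2011 §1.2–1.3, §10.1); no published fact is used.
-/

-- single-problem summit: the doubled namespace component is forced
set_option linter.dupNamespace false

noncomputable section

namespace Summit.ResolutionOfSingularities.ResolutionOfSingularities.Theorems.FRationalResolution

open CategoryTheory AlgebraicGeometry TopologicalSpace
open Literature.AlgebraicGeometry.Resolution

section Toric

variable (k : Type) [Field k]

/-- The Laurent polynomial ring `k[ℤ²]` (coordinate ring of the 2-torus). -/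
local notation3 "Lk" => AddMonoidAlgebra k (ℤ × ℤ)

/-- The lattice points of the dual cone `σ∨ = {m₂ ≥ 0, a m₂ ≤ r m₁}` of `σ = cone((0,1),(r,-a))`. -/
local notation3 "σS[" r ", " a "]" =>
  {m : ℤ × ℤ | 0 ≤ m.2 ∧ ((a : ℕ) : ℤ) * m.2 ≤ ((r : ℕ) : ℤ) * m.1}

/-- The toric surface algebra `k[σ∨ ∩ ℤ²] ⊆ k[ℤ²]`. -/
local notation3 "TA[" r ", " a "]" =>
  Algebra.adjoin k ((fun m : ℤ × ℤ => AddMonoidAlgebra.single m (1 : k)) '' σS[r, a])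

/-- **EVERY AFFINE TORIC SURFACE `U(r,a)` — ALL `r, a : ℕ`, EVERY FIELD — HAS A RESOLUTION OF SINGULARITIES.**
`r = 0`: the degenerate algebras `TA[0,a]` (`k[t,t⁻¹]`, `k[t,t⁻¹][s]`) are regular; `r ≥ 1`: reduce `a` modulo `r`
by a unimodular change of coordinates and apply the Hirzebruch–Jung tower `hasResolution_toricSurface`.
[folklore; CoxLittleSchenck2011 Thm. 10.1.10] -/
theorem hasResolution_toricSurface_all (r a : ℕ) : Scheme.HasResolution (Spec (CommRingCat.of ↥TA[r, a])) := by
  rcases Nat.eq_zero_or_pos r with rfl | hr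
  · haveI : IsRegularRing (CommRingCat.of ↥TA[0, a]) := stub_toric_degenerate_isRegularRing k a
    exact (Scheme.isRegular_Spec (CommRingCat.of ↥TA[0, a])).hasResolution
  · obtain ⟨e⟩ := stub_toric_reduce_mod k r a hr
    have h := hasResolution_toricSurface k r (a % r) (Nat.mod_lt a hr)
    -- transport along the scheme isomorphism `Spec TA[r, a % r] ≅ Spec TA[r, a]` induced by `e`
    exact Scheme.HasResolution.of_iso (Spec.map (e.toRingEquiv.toCommRingCatIso).hom) h

/-- For `1 ≤ r` the monomials `x = χ^(1,0)` and `w = χ^(a,r)` lie in a common prime of `TA[r,a]` (a vertex exists):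
the ideal `(x, w)` is proper, because the constant coefficient of `s·x + t·w` vanishes for `s, t ∈ TA[r,a]`
(`(−1, 0), (−a, −r) ∉ σS[r,a]`). [folklore] -/
theorem toric_exists_vertex (r a : ℕ) (hr : 1 ≤ r) (x w : ↥TA[r, a])
    (hx : (x : Lk) = AddMonoidAlgebra.single ((1 : ℤ), (0 : ℤ)) 1)
    (hw : (w : Lk) = AddMonoidAlgebra.single ((a : ℤ), (r : ℤ)) 1) :
    ∃ q : PrimeSpectrum ↥TA[r, a], x ∈ q.asIdeal ∧ w ∈ q.asIdeal := by
  have hne : Ideal.span ({x, w} : Set ↥TA[r, a]) ≠ ⊤ := by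
    intro htop
    have h1 : (1 : ↥TA[r, a]) ∈ Ideal.span ({x, w} : Set ↥TA[r, a]) := by rw [htop]; trivial
    rw [Ideal.mem_span_pair] at h1
    obtain ⟨s, t, hst⟩ := h1
    have hcoe := congrArg (fun z : ↥TA[r, a] => (z : Lk).coeff (0, 0)) hst
    simp only [Subalgebra.coe_add, Subalgebra.coe_mul, hx, hw, Subalgebra.coe_one, AddMonoidAlgebra.coeff_add,
      Finsupp.add_apply, AddMonoidAlgebra.coeff_mul_single_apply, mul_one, AddMonoidAlgebra.one_def,
      AddMonoidAlgebra.coeff_single] at hcoe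
    -- coefficients of cone-supported elements vanish outside the cone
    have hzero : ∀ (z : ↥TA[r, a]) (m : ℤ × ℤ), m ∉ σS[r, a] → (z : Lk).coeff m = 0 := fun z m hm => by
      by_contra hne0
      exact hm ((toricRetract_mem_iff k r a (z : Lk)).mp z.2 _ (Finsupp.mem_support_iff.mpr hne0))
    have h1 : ((0, 0) + -((1 : ℤ), (0 : ℤ)) : ℤ × ℤ) ∉ σS[r, a] := by
      rintro ⟨-, h2⟩
      simp only [Prod.neg_mk, Prod.mk_add_mk, neg_zero, add_zero, zero_add, mul_zero, mul_neg, mul_one] at h2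
      have hr' : (0 : ℤ) < r := by exact_mod_cast hr
      linarith
    have h2 : ((0, 0) + -((a : ℤ), (r : ℤ)) : ℤ × ℤ) ∉ σS[r, a] := by
      rintro ⟨h3, -⟩
      simp only [Prod.neg_mk, Prod.mk_add_mk, zero_add] at h3
      have hr' : (0 : ℤ) < r := by exact_mod_cast hr
      linarith
    rw [hzero s _ h1, hzero t _ h2] at hcoe
    erw [Finsupp.single_eq_same] at hcoe
    norm_num at hcoe
  obtain ⟨M, hM, hle⟩ := Ideal.exists_le_maximal _ hne
  refine ⟨⟨M, hM.isPrime⟩, hle (Ideal.subset_span (by simp)), hle (Ideal.subset_span (by simp))⟩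

/-- **The vertex of `U(r,a)` is a singular point** (`1 ≤ a < r`): its local ring — `𝒪_{U,q} ≅ TA[r,a]_q`
(`Spec.stalkIso`) — is not regular (`stub_toric_vertex_not_regular`, with `dim TA[r,a] = 2` from
`stub_toric_ringKrullDim`). [folklore; CLS2011 Thm. 1.3.12] -/
theorem toric_vertex_not_mem_regularLocus (r a : ℕ) (ha : 1 ≤ a) (har : a < r) (x w : ↥TA[r, a])
    (hx : (x : Lk) = AddMonoidAlgebra.single ((1 : ℤ), (0 : ℤ)) 1)
    (hw : (w : Lk) = AddMonoidAlgebra.single ((a : ℤ), (r : ℤ)) 1)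
    (q : Spec (CommRingCat.of ↥TA[r, a])) (hq : x ∈ q.asIdeal ∧ w ∈ q.asIdeal) :
    q ∉ Scheme.regularLocus (Spec (CommRingCat.of ↥TA[r, a])) := by
  intro hreg
  have hdim := stub_toric_ringKrullDim k r a (by omega) har.le
  have hnot := stub_toric_vertex_not_regular k r a ha har hdim x w hx hw q hq
  haveI : IsRegularLocalRing ((Spec (CommRingCat.of ↥TA[r, a])).presheaf.stalk q) := hreg
  exact hnot (IsRegularLocalRing.of_ringEquiv (Spec.stalkIso (CommRingCat.of ↥TA[r, a]) q).commRingCatIsoToRingEquiv)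

/-- **`Reg U(r,a) = D(x) ∪ D(w)` for `1 ≤ a < r`, unconditionally** (`toric_regularLocus_eq` at a vertex supplied by
`toric_exists_vertex`, singular by `toric_vertex_not_mem_regularLocus`). [folklore] -/
theorem toric_regularLocus_eq_of_lt (r a : ℕ) (ha : 1 ≤ a) (har : a < r) (x w : ↥TA[r, a])
    (hx : (x : Lk) = AddMonoidAlgebra.single ((1 : ℤ), (0 : ℤ)) 1)
    (hw : (w : Lk) = AddMonoidAlgebra.single ((a : ℤ), (r : ℤ)) 1)
    (hReg : IsOpen (Scheme.regularLocus (Spec (CommRingCat.of ↥TA[r, a])))) :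
    ((PrimeSpectrum.basicOpen x ⊔ PrimeSpectrum.basicOpen w : (Spec (CommRingCat.of ↥TA[r, a])).Opens)) =
      ⟨Scheme.regularLocus (Spec (CommRingCat.of ↥TA[r, a])), hReg⟩ := by
  obtain ⟨q, hq⟩ := toric_exists_vertex k r a (by omega) x w hx hw
  exact toric_regularLocus_eq k r a har x w hx hw q hq
    (toric_vertex_not_mem_regularLocus k r a ha har x w hx hw q hq) hReg

end Toric

end Summit.ResolutionOfSingularities.ResolutionOfSingularities.Theorems.FRationalResolution

end
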